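import Summits.KontsevichZagierPeriods.KontsevichZagierPeriods.Theorems.HermiteRigidityIslandComplementBoxDuplication
import Literature.NumberTheory.Transcendental.KZRelationsLE

/-!
# `ReductionRigidity` (stmt-KontsevichZagierPeriods-3407), line `Sketch`, cycle 3 (the duplication join island):
# the duplication chain at level `N`, scaled by a rational `ε` (`stub_dupJoinScaled`)

Route `KontsevichZagierPeriods/HermiteRigidity`, crux `ReductionRigidity` (stmt-3407); registered
sub-goal stub D2 of the DUPLICATION JOIN ISLAND (the box sectors at the levels `N`, `−N` and `N²` of an
integer `N ≥ 2`). For every rational `ε`, in normal-form syntax,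

  `[□², ε/(N² − xy)] − [□², 2ε/(N − xy)] − [□², 2ε/((−N) − xy)] ∈ KZ.relations`

— the weight-two cross-level reduction of the level `N²`: the level-`(−N)` normal form is
`[□², 2ε/((−N) − xy)] = −[□², 2ε/(N + xy)]`, and the duplication chain (`stub_boxDuplication N`:
`[□², 1/(N² − xy)] − [□², 2/(N − xy)] + [□², 2/(N + xy)] ∈ relations`, the coordinate-squaring move)
is pushed through the rational scaling endomorphism `KZ.scale ε` (`[σ, f] ↦ [σ, ε f]`, which
preserves `KZ.relations`: `KZ.scale_mem_relations`), then three congruences (rule 1b) pass to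
arbitrary representations with the printed integrands.

References: M. Kontsevich, D. Zagier, *Periods* (2001), §1.2 rules (1)–(2) [cite: KontsevichZagier2001, §1.2].
No definitions are introduced.
-/

noncomputable section

open MeasureTheory Set MvPolynomial

namespace Summit.KontsevichZagierPeriods.HermiteRigidity.ReductionRigidity

open Literature.NumberTheory.Transcendental
open Literature.NumberTheory.Transcendental.KZ

/-- **Stub `stub_dupJoinScaled`** (sub-goal D2 of crux `ReductionRigidity`, stmt-3407, line `Sketch`,
cycle 3: the duplication join island): **the duplication chain at level `N`, scaled by a rational `ε`,
in normal-form syntax.** For every integer `N ≥ 2`, every rational `ε` and any representations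
`s₂, sN, sNeg` on the closed square with the printed integrands on it,
`[□², ε/(N² − xy)] − [□², 2ε/(N − xy)] − [□², 2ε/((−N) − xy)] ∈ KZ.relations`:
`stub_boxDuplication N` on the regular rational representatives of `exists_rfun_boxDuplication`, the
scaling endomorphism `KZ.scale ε` (`KZ.scale_mem_relations`), and three congruences (rule 1b; the
last one with the sign `(−N) − xy = −(N + xy)`). [cite: KontsevichZagier2001, §1.2 rules (1)–(2)] -/
theorem stub_dupJoinScaled : ∀ (N : ℕ), 2 ≤ N → ∀ (ε : ℚ) (s₂ sN sNeg : IntegralRep 2),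
    s₂.domain = cube 2 → EqOn s₂.integrand (fun p => (ε : ℝ) / ((N : ℝ) ^ 2 - p 0 * p 1)) (cube 2) →
    sN.domain = cube 2 → EqOn sN.integrand (fun p => ((2 * ε : ℚ) : ℝ) / ((N : ℝ) - p 0 * p 1)) (cube 2) →
    sNeg.domain = cube 2 →
    EqOn sNeg.integrand (fun p => ((2 * ε : ℚ) : ℝ) / ((-(N : ℝ)) - p 0 * p 1)) (cube 2) →
    KZ.of s₂ - KZ.of sN - KZ.of sNeg ∈ KZ.relations := by
  intro N hN ε s₂ sN sNeg h₂ h₂i hN' hNi hNeg hNegi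
  have h2 : (2:ℝ) ≤ (N:ℝ) := by exact_mod_cast hN
  obtain ⟨R, W, S, T, hR, -, hS, hT⟩ := exists_rfun_boxDuplication hN
  -- the duplication chain at level `N` on the regular rational representatives, scaled by `ε`
  have hD : KZ.of R.rep - KZ.of S.rep + KZ.of T.rep ∈ KZ.relations :=
    stub_boxDuplication N hN R.rep S.rep T.rep rfl (fun x hx => hR x hx) rfl (fun x hx => hS x hx)
      rfl fun x hx => hT x hx
  have hε : IsAlgebraic ℚ ((ε : ℚ) : ℝ) := isAlgebraic_rat ℚ ε
  have hSc := KZ.scale_mem_relations (ε : ℝ) hε hD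
  simp only [map_add, map_sub, KZ.scale_of] at hSc
  -- congruences with the given representations
  have e₁ : KZ.of s₂ - KZ.of (R.rep.constMul (ε : ℝ) hε) ∈ KZ.relations :=
    KZ.of_sub_of_mem_relations_of_eqOn
      (by rw [KZ.IntegralRep.domain_constMul, RFun.rep_domain, h₂]) fun x hx => by
        rw [h₂] at hx
        simp only [KZ.IntegralRep.integrand_constMul, RFun.rep_integrand]
        rw [h₂i hx, hR x hx]
        ring
  have e₂ : KZ.of sN - KZ.of (S.rep.constMul (ε : ℝ) hε) ∈ KZ.relations :=
    KZ.of_sub_of_mem_relations_of_eqOn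
      (by rw [KZ.IntegralRep.domain_constMul, RFun.rep_domain, hN']) fun x hx => by
        rw [hN'] at hx
        simp only [KZ.IntegralRep.integrand_constMul, RFun.rep_integrand]
        rw [hNi hx, hS x hx]
        push_cast
        ring
  have e₃ : KZ.of sNeg + KZ.of (T.rep.constMul (ε : ℝ) hε) ∈ KZ.relations :=
    KZ.of_add_of_mem_relations_of_eqOn_neg
      (by rw [KZ.IntegralRep.domain_constMul, RFun.rep_domain, hNeg]) fun x hx => by
        rw [hNeg] at hx
        simp only [KZ.IntegralRep.integrand_constMul, RFun.rep_integrand, Pi.neg_apply]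
        rw [hNegi hx, hT x hx]
        dsimp only
        rw [show (-(N:ℝ)) - x 0 * x 1 = -((N:ℝ) + x 0 * x 1) by ring, div_neg]
        push_cast
        ring
  have e : KZ.of s₂ - KZ.of sN - KZ.of sNeg =
      (KZ.of s₂ - KZ.of (R.rep.constMul (ε : ℝ) hε)) - (KZ.of sN - KZ.of (S.rep.constMul (ε : ℝ) hε)) -
        (KZ.of sNeg + KZ.of (T.rep.constMul (ε : ℝ) hε)) +
        (KZ.of (R.rep.constMul (ε : ℝ) hε) - KZ.of (S.rep.constMul (ε : ℝ) hε) +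
          KZ.of (T.rep.constMul (ε : ℝ) hε)) := by abel
  rw [e]
  exact KZ.relations.add_mem (KZ.relations.sub_mem (KZ.relations.sub_mem e₁ e₂) e₃) hSc

end Summit.KontsevichZagierPeriods.HermiteRigidity.ReductionRigidity

end
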